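import Summits.AtomisticToContinuum.BoseEinsteinCondensation.Theorems.BECRieszReverseHolderCoarseGrainedReverseHolderStubRieszFieldMomentPinned
import Literature.MathematicalPhysics.StatisticalMechanics.PeriodicRieszKernelFourier
import Literature.MathematicalPhysics.StatisticalMechanics.PeriodicRieszKernelCellMean
import Literature.MathematicalPhysics.QuantumManyBody.PeriodicBoseGas
import HarnessLib

/-!
# The Gibbs mean energy of the zero-mean periodic Riesz gas is non-positive
(route BECRieszReverseHolder)

Line `registered` of crux stmt-AtomisticToContinuum-12840 `CoarseGrainedReverseHolder`; registered
sub-goal `stub_gibbsMeanEnergyNonpos` (S4′B), the averaged half of the classical engine in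
variance form.

Setting: the flat torus cell `[0,L)³`, the smeared periodic Riesz-2 kernel
`g = periodicRieszKernel 2 L η` (continuous, `Lℤ³`-periodic along the axes, ZERO CELL MEAN
`∫_{[0,L)³} g = 0`), and the pair energy `H(X) = Σ_{i<j} g(X_i − X_j)` on `[0,L)^{3n}`.
CLAIM: `∫_{[0,L)^{3n}} H e^{-bH} dX ≤ 0` for every `b ≥ 0`.

Proof. (1) `∫_{[0,L)^{3n}} H = 0`: by linearity it suffices that `∫ g(X_i − X_j) dX = 0` for
`i ≠ j`; relabel `i ↦ 0` (`RieszFieldMoment.setIntegral_cellN_comp_perm`), integrate the tagged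
coordinate first (`BoseGas.setIntegral_cellN_succ_right_of_continuous`) and use shift invariance
of the one-particle cell integral of the periodic `g`: `∫_{[0,L)³} g(x − c) dx = ∫_{[0,L)³} g = 0`
(`integral_cell_periodicRieszKernel`). (2) Pointwise `H · (e^{-bH} − 1) ≤ 0` for `b ≥ 0` (the two
factors have opposite signs), whence `∫ H e^{-bH} = ∫ H (e^{-bH} − 1) + ∫ H ≤ 0 + 0` — Chebyshev's
association inequality for the antitone `t ↦ e^{-bt}` at the centring `∫ H = 0`.
-/

namespace Summit.AtomisticToContinuum.BoseEinsteinCondensation.Theorems.CoarseGrainedReverseHolder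

open MeasureTheory
open Literature.MathematicalPhysics.QuantumManyBody Literature.MathematicalPhysics.StatisticalMechanics
open BoseGas

namespace GibbsMeanEnergy

variable {L : ℝ}

/-! ### One particle: shift invariance of the cell integral -/

/-- One particle: `∫_{[0,L)^{3·1}} u(X_0) dX = ∫_{[0,L)³} u` (Bochner version of
`BoseGas.lintegral_cellN_one`). -/
theorem setIntegral_cellN_one (L : ℝ) (u : Space → ℝ) :
    ∫ X in cellN 1 L, u (X 0) = ∫ y in cell L, u y := by
  -- adapted from `BoseGas.lintegral_cellN_one` (PeriodicBoseGasImpurityTranslation)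
  have hpre : cellN 1 L = (MeasurableEquiv.funUnique (Fin 1) Space) ⁻¹' cell L := by
    ext X
    exact ⟨fun h => h 0, fun h i => by rw [Fin.eq_zero i]; exact h⟩
  rw [hpre]
  exact (volume_preserving_funUnique (Fin 1) Space).setIntegral_preimage_emb
    (MeasurableEquiv.funUnique (Fin 1) Space).measurableEmbedding u (cell L)

/-- **Shift invariance of the one-particle cell integral of a periodic function**:
`∫_{[0,L)³} u(x + a) dx = ∫_{[0,L)³} u(x) dx` (the `N`-particle torus shift
`BoseGas.setIntegral_cellN_comp_add_of_periodic` at `N = 1`). -/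
theorem setIntegral_cell_comp_add (hL : 0 < L) {u : Space → ℝ} (hu : Continuous u)
    (hper : ∀ (x : Space) (k : Fin 3), u (x + EuclideanSpace.single k L) = u x) (a : Space) :
    ∫ x in cell L, u (x + a) = ∫ x in cell L, u x := by
  have hperN : ∀ (X : Config 1) (i : Fin 1) (k : Fin 3),
      (fun X : Config 1 => u (X 0)) (X + Pi.single i (EuclideanSpace.single k L)) =
        (fun X : Config 1 => u (X 0)) X := by
    intro X i k
    rw [Fin.eq_zero i]
    simp only [Pi.add_apply, Pi.single_eq_same, hper]
  calc ∫ x in cell L, u (x + a) = ∫ X in cellN 1 L, u (X 0 + a) :=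
        (setIntegral_cellN_one L (fun x => u (x + a))).symm
    _ = ∫ X in cellN 1 L, u (X 0) :=
        setIntegral_cellN_comp_add_of_periodic hL (F := fun X : Config 1 => u (X 0))
          (hu.comp (continuous_apply 0)).aestronglyMeasurable hperN (fun _ => a)
    _ = ∫ x in cell L, u x := setIntegral_cellN_one L u

/-! ### Zero mean of the pair energy -/

/-- The shifted kernel still has zero cell mean: `∫_{[0,L)³} g(x − c) dx = 0`. -/
theorem setIntegral_cell_rieszKernel_sub (hL : 0 < L) {η : ℝ} (hη : η ≠ 0) (c : Space) :
    ∫ x in cell L, periodicRieszKernel 2 L η (x - c) = 0 := by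
  simp_rw [sub_eq_add_neg]
  rw [setIntegral_cell_comp_add hL (continuous_periodicRieszKernel 2 hL hη)
    (periodicRieszKernel_add_single 2 L η) (-c)]
  exact integral_cell_periodicRieszKernel 2 hL hη

/-- **One pair term has zero cell integral**: `∫_{[0,L)^{3n}} g(X_i − X_j) dX = 0` for `i ≠ j`
(relabel `i ↦ 0`, integrate the tagged coordinate first, shift invariance). -/
theorem setIntegral_cellN_pair (hL : 0 < L) {η : ℝ} (hη : η ≠ 0) {n : ℕ} {i j : Fin n}
    (hij : i ≠ j) : ∫ X in cellN n L, periodicRieszKernel 2 L η (X i - X j) = 0 := by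
  obtain _ | m := n
  · exact i.elim0
  have hj0 : Equiv.swap 0 i j ≠ 0 := by
    intro h
    rw [Equiv.apply_eq_iff_eq_symm_apply, Equiv.symm_swap, Equiv.swap_apply_left] at h
    exact hij h.symm
  obtain ⟨k, hk⟩ := Fin.exists_succ_eq.2 hj0
  have hg : Continuous (periodicRieszKernel 2 L η) := continuous_periodicRieszKernel 2 hL hη
  calc ∫ X in cellN (m + 1) L, periodicRieszKernel 2 L η (X i - X j)
      = ∫ X in cellN (m + 1) L, (fun Y : Config (m + 1) =>
          periodicRieszKernel 2 L η (Y 0 - Y (Equiv.swap 0 i j))) (X ∘ Equiv.swap 0 i) := by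
        refine setIntegral_congr_fun (measurableSet_cellN _ L) fun X _ => ?_
        simp only [Function.comp_apply, Equiv.swap_apply_left, Equiv.swap_apply_self]
    _ = ∫ Y in cellN (m + 1) L, periodicRieszKernel 2 L η (Y 0 - Y (Equiv.swap 0 i j)) :=
        RieszFieldMoment.setIntegral_cellN_comp_perm (Equiv.swap 0 i)
          (fun Y : Config (m + 1) => periodicRieszKernel 2 L η (Y 0 - Y (Equiv.swap 0 i j)))
    _ = ∫ X in cellN m L, ∫ x in cell L, periodicRieszKernel 2 L η (x - X k) := by
        rw [setIntegral_cellN_succ_right_of_continuous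
          (F := fun Y : Config (m + 1) => periodicRieszKernel 2 L η (Y 0 - Y (Equiv.swap 0 i j)))
          (hg.comp ((continuous_apply 0).sub (continuous_apply _)))]
        refine setIntegral_congr_fun (measurableSet_cellN _ L) fun X _ => ?_
        refine setIntegral_congr_fun (measurableSet_cell L) fun x _ => ?_
        rw [← hk]
        simp only [Matrix.cons_val_zero, Matrix.cons_val_succ]
    _ = 0 := by
        simp only [setIntegral_cell_rieszKernel_sub hL hη, integral_zero]

/-- **Zero mean energy**: `∫_{[0,L)^{3n}} Σ_{i<j} g(X_i − X_j) dX = 0`. -/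
theorem setIntegral_cellN_pairSum (hL : 0 < L) {η : ℝ} (hη : η ≠ 0) (n : ℕ) :
    ∫ X in cellN n L, ∑ i : Fin n, ∑ j : Fin n with i < j,
      periodicRieszKernel 2 L η (X i - X j) = 0 := by
  have hg : Continuous (periodicRieszKernel 2 L η) := continuous_periodicRieszKernel 2 hL hη
  have hint : ∀ i j : Fin n, IntegrableOn
      (fun X : Config n => periodicRieszKernel 2 L η (X i - X j)) (cellN n L) volume :=
    fun i j => integrableOn_cellN (hg.comp ((continuous_apply i).sub (continuous_apply j))) L
  rw [integral_finsetSum _ fun i _ => integrable_finsetSum _ fun j _ => hint i j]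
  refine Finset.sum_eq_zero fun i _ => ?_
  rw [integral_finsetSum _ fun j _ => hint i j]
  refine Finset.sum_eq_zero fun j hj => ?_
  exact setIntegral_cellN_pair hL hη (Finset.mem_filter.1 hj).2.ne

/-- **Chebyshev at the centring `0`, pointwise**: `t (e^{-bt} − 1) ≤ 0` for `b ≥ 0`. -/
theorem mul_exp_neg_mul_sub_one_nonpos {b : ℝ} (hb : 0 ≤ b) (t : ℝ) :
    t * (Real.exp (-(b * t)) - 1) ≤ 0 := by
  rcases le_total 0 t with h | h
  · exact mul_nonpos_of_nonneg_of_nonpos h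
      (sub_nonpos.2 (Real.exp_le_one_iff.2 (neg_nonpos.2 (mul_nonneg hb h))))
  · exact mul_nonpos_of_nonpos_of_nonneg h
      (sub_nonneg.2 (Real.one_le_exp_iff.2 (neg_nonneg.2 (mul_nonpos_of_nonneg_of_nonpos hb h))))

end GibbsMeanEnergy

/-- **S4′B — the Gibbs mean energy of the zero-mean pair energy is non-positive.** For `0 < L`,
`0 ≤ b`, `0 < η`, `g = periodicRieszKernel 2 L η` and `H(X) = Σ_{i<j} g(X_i − X_j)`:
`∫_{[0,L)^{3n}} H e^{-bH} dX ≤ 0`. Indeed `∫_{[0,L)^{3n}} H = 0` (zero cell mean of `g`, pair by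
pair) and `H (e^{-bH} − 1) ≤ 0` pointwise. -/
theorem stub_gibbsMeanEnergyNonpos : ∀ (n : ℕ) (L b η : ℝ), 0 < L → 0 ≤ b → 0 < η → ∀ H : BoseGas.Config n → ℝ, H = (fun X => ∑ i : Fin n, ∑ j : Fin n with i < j, periodicRieszKernel 2 L η (X i - X j)) → ∫ X in BoseGas.cellN n L, H X * Real.exp (-(b * H X)) ≤ 0 := by
  intro n L b η hL hb hη H hH
  have hHc : Continuous H := by
    rw [hH]
    exact continuous_finsetSum _ fun i _ => continuous_finsetSum _ fun j _ =>
      (continuous_periodicRieszKernel 2 hL hη.ne').comp ((continuous_apply i).sub (continuous_apply j))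
  have hH0 : ∫ X in cellN n L, H X = 0 := by
    rw [hH]
    exact GibbsMeanEnergy.setIntegral_cellN_pairSum hL hη.ne' n
  have hi1 : IntegrableOn H (cellN n L) volume := integrableOn_cellN hHc L
  have hi2 : IntegrableOn (fun X => H X * (Real.exp (-(b * H X)) - 1)) (cellN n L) volume :=
    integrableOn_cellN (hHc.mul ((Real.continuous_exp.comp (continuous_const.mul hHc).neg).sub
      continuous_const)) L
  have hsplit : (fun X => H X * Real.exp (-(b * H X))) =
      fun X => H X * (Real.exp (-(b * H X)) - 1) + H X := by
    funext X; ring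
  rw [hsplit, integral_add hi2 hi1, hH0, add_zero]
  exact integral_nonpos fun X => GibbsMeanEnergy.mul_exp_neg_mul_sub_one_nonpos hb (H X)

end Summit.AtomisticToContinuum.BoseEinsteinCondensation.Theorems.CoarseGrainedReverseHolder
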